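import Summits.QuantumFields.YangMills.Theorems.UnitScaleTiltProp7CurvedMemberGradientRowOfRegPr
import Summits.QuantumFields.YangMills.Theorems.UnitScaleTiltProp7LODSlotK2WindowLetters
import HarnessLib

/-!
# Route `UnitScaleTilt`, crux K1 «MinimiserStabilityRegPr» (stmt-QuantumFields-19200), EX row `h349` after S45 — (L3′b)-GRAD FILE **(ii-d): THE CURVED MEMBER GRADIENT ROW AT THE PIN,
# WITH A MEMBER-FREE CONSTANT** — px19 g13's (ii-c) ✓`Prop7CurvedMemberGradientRowOfRegPr.column_gradient_decay_of_regPr` (V6's gradient-column letter `hDcol` from `RegPr`, the LOD letters,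
# `hroom`, `hsmall`) READ AT ★p1's pin `c₁ := c₀·(L³)^{K−n}`: V4's Agmon window DISCHARGED by routeR-w4's W1 real letters (✓`Prop7LODSlotK2WindowLetters.window_delta`), and the 2.5-k-char
# constant REWRITTEN, leaf by leaf, into `Cg⋆(am, μ, ε₀)` — a number that does NOT depend on the member `(K, n)`, nor on `c₀`, nor on the volume: `(5∕4)√(2c₁)·ℓ⁻³∕c₀·√(2c₁) = 5∕2`,
# `√(25∕8·c₁ℓ⁻³∕c₀) = √(25∕8)`, `√(max 2 (16c₀ℓ³∕(am·c₁)))² = max 2 (16∕am)`, and V4's `B₂` leaf PAIRS with the trailing `√(2c₁)`: `√(3³∕(c₀ℓ³)·8)·√(2c₀(L³)^{K−n}) = √432`.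
# This is the `hDcolU` input of the Idx knit (✓∕⧗`Prop7KernelRow349MemberKnit.kernelRow349_member_of_gradColU`, px10 g12), whose `C349 L` must be ONE number per family.

Cell `ym3-torus` (HUMAN RULING D-0037; rung R3 = SU(2) YM₃ on T³ — NOT d = 4, NOT infinite volume, NOT a mass gap, NOT Clay).  Width seat `ym3-torus-px10` (gen 12); px19 g13 2026-08-30
06:49:22Z «(ii-d) is YOURS — GO NOW»; namer w2 g12 division 06:44:47Z (b).  THEOREMS ONLY (0 `def`, 0 `sorry`, default heartbeats); `--supports stmt-QuantumFields-19200 --as helper`; count-neutral.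

WHAT IS PROVED (ns `Summit.QuantumFields.YangMills.Theorems.Prop7CurvedMemberGradientRowPin`).
* §1 the four leaf identities at the pin (pure real algebra over `Real.mul_self_sqrt`∕`Real.sq_sqrt`∕`Real.sqrt_mul`, `(L³)^{K−n} = (L^{K−n})³`): `unitA_pin` (`= 5∕2`), `unitU1_pin`, `unitU2_pin`,
  ★`unitU3_pin` (`B₂`-leaf × `√(2c₁)` `= √432·(…)`) — their LEFT sides are (ii-c)'s syntactic units VERBATIM (generated from the tree text by script, `gen/gen_iid.py`).
* §2 ★★★ `column_gradient_decay_pin` — (ii-c) with `a := am`, `c₁ := c₀(L³)^{K−n}` (`[Fact (0 < c₀(L³)^{K−n})]` instance binder, as in ✓p764315), V4's window rows `hδ`∕`hwin` DISCHARGED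
  (`δ₁ := √(27 + 2025am∕8)·μ`, `3μ ≤ 1`, displayed numeric `hwinμ : √(max 2 (16∕am))·(√(27+2025am∕8)·μ) ≤ 1∕10`), `hroom`∕`hsmall` displayed as in (ii-c); conclusion = V6's `hDcol` text with
  the MEMBER-FREE constant `Cg⋆(am, μ, ε₀)` (958 ch; atoms: `exists_curved_localGradient.choose`, `norm_bgOfCfg_axialT_sub_le.choose`, `am`, `μ`, `ε₀`) and rate `min μ ¼ ∕ 2`.
HYP-SAT (★★OWNER RULING №42).  As (ii-c): `hreg`, the LOD letters at the pin (inhabited by `rfl`∕adjoint∕✓`exists_massive_inverse`), `hroom` (CHAIR WORD №1∕№3 class — true for members with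
`13 ≤ L^{F.m+n}`; the small ones go by px12 g16's (c2″) ✓∕⧗`Prop7KernelRow349OfCover`), `hsmall` (print's smallness of `ε₀`, K-free), `3μ ≤ 1` and `hwinμ` (W1 ✓`window_win` is EQUALITY at
`μ = 1∕(10√(max 2 (16∕am))√(27+2025am∕8))`); conclusion non-vacuous; no `Prop` placeholder.
HONEST SCOPE.  An equality rewrite over (ii-c) + W1's real letters; nothing of (ii-c) itself, V6, `hK349`, `h349`, the ten EX rows, `hThm2S`, EX `stub_existenceMinimalOrbit` or the crux is proved
here; the Yang–Mills mass gap is NOT proved.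

References: T. Bałaban, CMP **99** (1985) 389–434 [Balaban1985BackgroundPropagators] (Thm 3.1 (3.42)–(3.44) pp.397–398, (3.24) p.394, (3.49) p.399); CMP **95** (1984) 17–40
[Balaban1984PropagatorsI] (p.36).
-/

set_option autoImplicit false

noncomputable section

open scoped BigOperators Matrix.Norms.L2Operator InnerProductSpace ComplexConjugate Matrix

namespace Summit.QuantumFields.YangMills.Theorems.Prop7CurvedMemberGradientRowPin

open Literature.MathematicalPhysics.QuantumFieldTheory.Balaban1983to89
open Literature.MathematicalPhysics.QuantumFieldTheory.Balaban1983to89.T3ContinuumYM3Torus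
open T4Continuum BlockAveraging
open BlockAveraging (Idx)
open B7Prop1Explicit (disp)
open B5Eq118OneStroke (iterBlockOf)
open B10Eq27TorusAxialLog (holT transl)
open B7TransferAnalyticMean (meanCLM)
open B4Sect5Torus (TSite)
open B9Eq311L2Pairing (WL2)
open B11Eq103H1Complex (SiteL2K)
open Summit.QuantumFields.YangMills.Theorems.Prop8Chart (emlIterU)
open T3SectALandauChart (eta eta_pos bgUnits)
open T3PrintedRegularMinimiser (RegPr)
open T3PrintedRegularOrbits (sites_eq)
open T3LevelShift (siteShift)
open Summit.QuantumFields.YangMills.Theorems.Prop7SectET3Transport (periodsT3 siteEquiv bondEquiv)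
open Summit.QuantumFields.YangMills.Theorems.Prop7SectET3HilbertLetters (W₂ toL2S DL2 covLapSite)
open Summit.QuantumFields.YangMills.Theorems.Prop7CurvedMemberLocalGradient (exists_curved_localGradient)
open Summit.QuantumFields.YangMills.Theorems.AxialGaugeChartGlue (norm_bgOfCfg_axialT_sub_le)
open Summit.QuantumFields.YangMills.Theorems.Prop7CurvedMemberGradientRowOfRegPr (column_gradient_decay_of_regPr)
open Summit.QuantumFields.YangMills.Theorems.Prop7LODSlotK2WindowLetters (window_delta)

/-! ## §1 The four leaves of (ii-c)'s constant at the pin `c₁ = c₀·(L³)^{K−n}` -/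

section Pin

variable (F : T3Family) {n K : ℕ} {c₀ : ℝ}

/-- **(A) THE SOURCE LEAF AT THE PIN**: `(5∕4)·√(2c₁)·((L^d)^{K−n})⁻¹∕c₀·√(2c₁) = 5∕2` at `c₁ = c₀(L³)^{K−n}` (V2b's `A_src`). [cite: Balaban1985BackgroundPropagators, (3.24) p.394] -/
theorem unitA_pin (hc₀ : 0 < c₀) :
    (5 / 4) * Real.sqrt (2 * (c₀ * ((F.L : ℝ) ^ 3) ^ (K - n))) * ((((F.P K).L : ℝ) ^ (F.P K).d) ^ (K - n))⁻¹ / c₀ * Real.sqrt (2 * (c₀ * ((F.L : ℝ) ^ 3) ^ (K - n))) = (5 / 2 : ℝ) := by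
  have hL : (0 : ℝ) < F.L := by have := F.hL.2; exact_mod_cast (by omega : 0 < F.L)
  have hPL : ((F.P K).L : ℝ) = (F.L : ℝ) := by norm_cast
  have hX : ((((F.P K).L : ℝ) ^ (F.P K).d) ^ (K - n)) = ((F.L : ℝ) ^ 3) ^ (K - n) := by rw [hPL, T3Family.P_d]
  have hc₁ : 0 ≤ 2 * (c₀ * ((F.L : ℝ) ^ 3) ^ (K - n)) := by positivity
  have hr2 : Real.sqrt (2 * (c₀ * ((F.L : ℝ) ^ 3) ^ (K - n))) * Real.sqrt (2 * (c₀ * ((F.L : ℝ) ^ 3) ^ (K - n))) = 2 * (c₀ * ((F.L : ℝ) ^ 3) ^ (K - n)) :=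
    Real.mul_self_sqrt hc₁
  rw [hX]
  have h3 : ((F.L : ℝ) ^ 3) ^ (K - n) ≠ 0 := by positivity
  calc (5 / 4 : ℝ) * Real.sqrt (2 * (c₀ * ((F.L : ℝ) ^ 3) ^ (K - n))) * (((F.L : ℝ) ^ 3) ^ (K - n))⁻¹ / c₀ * Real.sqrt (2 * (c₀ * ((F.L : ℝ) ^ 3) ^ (K - n)))
        = (5 / 4 : ℝ) * (Real.sqrt (2 * (c₀ * ((F.L : ℝ) ^ 3) ^ (K - n))) * Real.sqrt (2 * (c₀ * ((F.L : ℝ) ^ 3) ^ (K - n)))) * (((F.L : ℝ) ^ 3) ^ (K - n))⁻¹ / c₀ := by ring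
    _ = 5 / 2 := by rw [hr2]; field_simp; ring

/-- **(U1) THE PENALTY UNIT OF V4's `B₁` AT THE PIN** — the two `√(2c₁)` pair up: `= am·(5∕2)·(25∕8)·(8·max 2 (16∕am))`. [cite: Balaban1985BackgroundPropagators, Thm 3.1 (3.42) p.397] -/
theorem unitU1_pin (hc₀ : 0 < c₀) {am : ℝ} (ham : 0 < am) :
    ((am * ((5 / 4) * Real.sqrt (2 * (c₀ * ((F.L : ℝ) ^ 3) ^ (K - n))) * ((((F.P K).L : ℝ) ^ (F.P K).d) ^ (K - n))⁻¹ / c₀) * Real.sqrt ((25 / 8) * ((c₀ * ((F.L : ℝ) ^ 3) ^ (K - n)) * ((((F.P K).L : ℝ) ^ (F.P K).d) ^ (K - n))⁻¹ / c₀))) * ((8 * Real.sqrt (max 2 (16 * c₀ * ((F.L : ℝ) ^ (K - n)) ^ 3 / (am * (c₀ * ((F.L : ℝ) ^ 3) ^ (K - n))))) ^ 2) * (Real.sqrt ((25 / 8) * ((c₀ * ((F.L : ℝ) ^ 3) ^ (K - n)) * ((((F.P K).L : ℝ) ^ (F.P K).d) ^ (K - n))⁻¹ / c₀)) * Real.sqrt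 (2 * (c₀ * ((F.L : ℝ) ^ 3) ^ (K - n)))))) = (am * (5 / 2) * (25 / 8) * (8 * max 2 (16 / am))) := by
  have hL : (0 : ℝ) < F.L := by have := F.hL.2; exact_mod_cast (by omega : 0 < F.L)
  have hPL : ((F.P K).L : ℝ) = (F.L : ℝ) := by norm_cast
  have hX : ((((F.P K).L : ℝ) ^ (F.P K).d) ^ (K - n)) = ((F.L : ℝ) ^ 3) ^ (K - n) := by rw [hPL, T3Family.P_d]
  have h3 : ((F.L : ℝ) ^ 3) ^ (K - n) ≠ 0 := by positivity
  have hS : (25 / 8 : ℝ) * ((c₀ * ((F.L : ℝ) ^ 3) ^ (K - n)) * ((((F.P K).L : ℝ) ^ (F.P K).d) ^ (K - n))⁻¹ / c₀) = 25 / 8 := by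
    rw [hX]; field_simp
  have hM : 16 * c₀ * ((F.L : ℝ) ^ (K - n)) ^ 3 / (am * (c₀ * ((F.L : ℝ) ^ 3) ^ (K - n))) = 16 / am := by
    rw [← pow_mul, ← pow_mul, mul_comm (K - n) 3]
    have h3' : (F.L : ℝ) ^ (3 * (K - n)) ≠ 0 := by positivity
    field_simp
  have hr2 : Real.sqrt (2 * (c₀ * ((F.L : ℝ) ^ 3) ^ (K - n))) * Real.sqrt (2 * (c₀ * ((F.L : ℝ) ^ 3) ^ (K - n))) = 2 * (c₀ * ((F.L : ℝ) ^ 3) ^ (K - n)) :=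
    Real.mul_self_sqrt (by positivity)
  have hS2 : Real.sqrt (25 / 8 : ℝ) * Real.sqrt (25 / 8 : ℝ) = 25 / 8 := Real.mul_self_sqrt (by norm_num)
  have hM2 : Real.sqrt (max 2 (16 / am)) ^ 2 = max 2 (16 / am) := Real.sq_sqrt (le_trans zero_le_two (le_max_left _ _))
  rw [hS, hM, hM2]
  calc am * ((5 / 4 : ℝ) * Real.sqrt (2 * (c₀ * ((F.L : ℝ) ^ 3) ^ (K - n))) * ((((F.P K).L : ℝ) ^ (F.P K).d) ^ (K - n))⁻¹ / c₀) * Real.sqrt (25 / 8) * ((8 * max 2 (16 / am)) * (Real.sqrt (25 / 8) * Real.sqrt (2 * (c₀ * ((F.L : ℝ) ^ 3) ^ (K - n)))))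
        = am * (5 / 4 : ℝ) * ((Real.sqrt (2 * (c₀ * ((F.L : ℝ) ^ 3) ^ (K - n))) * Real.sqrt (2 * (c₀ * ((F.L : ℝ) ^ 3) ^ (K - n)))) * ((((F.P K).L : ℝ) ^ (F.P K).d) ^ (K - n))⁻¹ / c₀) * (Real.sqrt (25 / 8) * Real.sqrt (25 / 8)) * (8 * max 2 (16 / am)) := by ring
    _ = am * (5 / 2) * (25 / 8) * (8 * max 2 (16 / am)) := by rw [hr2, hS2, hX]; field_simp; ring

/-- **(U2) V4a's PENALTY LETTER `A_pen` PLUS THE SOURCE LEAF AT THE PIN**: `= am·(5∕2)·(25∕8)·(e^{3μ}·8·max 2 (16∕am)) + 5∕2`. [cite: Balaban1985BackgroundPropagators, (3.24) p.394] -/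
theorem unitU2_pin (hc₀ : 0 < c₀) {am : ℝ} (ham : 0 < am) (μ : ℝ) :
    ((am * ((5 / 4) * Real.sqrt (2 * (c₀ * ((F.L : ℝ) ^ 3) ^ (K - n))) * ((((F.P K).L : ℝ) ^ (F.P K).d) ^ (K - n))⁻¹ / c₀) * Real.sqrt ((25 / 8) * ((c₀ * ((F.L : ℝ) ^ 3) ^ (K - n)) * ((((F.P K).L : ℝ) ^ (F.P K).d) ^ (K - n))⁻¹ / c₀)) * (Real.exp (3 * μ) * (8 * Real.sqrt (max 2 (16 * c₀ * ((F.L : ℝ) ^ (K - n)) ^ 3 / (am * (c₀ * ((F.L : ℝ) ^ 3) ^ (K - n))))) ^ 2) * (Real.sqrt ((25 / 8) * ((c₀ * ((F.L : ℝ) ^ 3) ^ (K - n)) * ((((F.P K).L : ℝ) ^ (F.P K).d) ^ (K - n))⁻¹ / c₀)) * Real.sqrt (2 * (c₀ * ((F.L : ℝ) ^ 3) ^ (K - n)))))) + ((5 / 4) * Real.sqrt (2 * (c₀ * ((F.L : ℝ) ^ 3) ^ (K - n))) * ((((F.P K).L : ℝ) ^ (F.P K).d) ^ (K - n))⁻¹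 / c₀ * Real.sqrt (2 * (c₀ * ((F.L : ℝ) ^ 3) ^ (K - n))))) = (am * (5 / 2) * (25 / 8) * (Real.exp (3 * μ) * (8 * max 2 (16 / am))) + 5 / 2) := by
  have hL : (0 : ℝ) < F.L := by have := F.hL.2; exact_mod_cast (by omega : 0 < F.L)
  have hPL : ((F.P K).L : ℝ) = (F.L : ℝ) := by norm_cast
  have hX : ((((F.P K).L : ℝ) ^ (F.P K).d) ^ (K - n)) = ((F.L : ℝ) ^ 3) ^ (K - n) := by rw [hPL, T3Family.P_d]
  have h3 : ((F.L : ℝ) ^ 3) ^ (K - n) ≠ 0 := by positivity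
  have hS : (25 / 8 : ℝ) * ((c₀ * ((F.L : ℝ) ^ 3) ^ (K - n)) * ((((F.P K).L : ℝ) ^ (F.P K).d) ^ (K - n))⁻¹ / c₀) = 25 / 8 := by
    rw [hX]; field_simp
  have hM : 16 * c₀ * ((F.L : ℝ) ^ (K - n)) ^ 3 / (am * (c₀ * ((F.L : ℝ) ^ 3) ^ (K - n))) = 16 / am := by
    rw [← pow_mul, ← pow_mul, mul_comm (K - n) 3]
    have h3' : (F.L : ℝ) ^ (3 * (K - n)) ≠ 0 := by positivity
    field_simp
  have hr2 : Real.sqrt (2 * (c₀ * ((F.L : ℝ) ^ 3) ^ (K - n))) * Real.sqrt (2 * (c₀ * ((F.L : ℝ) ^ 3) ^ (K - n))) = 2 * (c₀ * ((F.L : ℝ) ^ 3) ^ (K - n)) :=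
    Real.mul_self_sqrt (by positivity)
  have hS2 : Real.sqrt (25 / 8 : ℝ) * Real.sqrt (25 / 8 : ℝ) = 25 / 8 := Real.mul_self_sqrt (by norm_num)
  have hM2 : Real.sqrt (max 2 (16 / am)) ^ 2 = max 2 (16 / am) := Real.sq_sqrt (le_trans zero_le_two (le_max_left _ _))
  have hA := unitA_pin F hc₀ (K := K) (n := n)
  rw [hA, hS, hM, hM2]
  congr 1
  calc am * ((5 / 4 : ℝ) * Real.sqrt (2 * (c₀ * ((F.L : ℝ) ^ 3) ^ (K - n))) * ((((F.P K).L : ℝ) ^ (F.P K).d) ^ (K - n))⁻¹ / c₀) * Real.sqrt (25 / 8) * (Real.exp (3 * μ) * (8 * max 2 (16 / am)) * (Real.sqrt (25 / 8) * Real.sqrt (2 * (c₀ * ((F.L : ℝ) ^ 3) ^ (K - n)))))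
        = am * (5 / 4 : ℝ) * ((Real.sqrt (2 * (c₀ * ((F.L : ℝ) ^ 3) ^ (K - n))) * Real.sqrt (2 * (c₀ * ((F.L : ℝ) ^ 3) ^ (K - n)))) * ((((F.P K).L : ℝ) ^ (F.P K).d) ^ (K - n))⁻¹ / c₀) * (Real.sqrt (25 / 8) * Real.sqrt (25 / 8)) * (Real.exp (3 * μ) * (8 * max 2 (16 / am))) := by ring
    _ = am * (5 / 2) * (25 / 8) * (Real.exp (3 * μ) * (8 * max 2 (16 / am))) := by rw [hr2, hS2, hX]; field_simp; ring

/-- **(U3) V4's `B₂` UNIT AT THE PIN — THE ONLY `ℓ`-CARRYING LEAF PAIRS EXACTLY**: `√(3³∕(c₀ℓ³)·8)·√(2c₀(L³)^{K−n}) = √432`, so `= √432·(W·(8·max 2 (16∕am)·√(25∕8)))` — member-free. [cite: Balaban1985BackgroundPropagators, Thm 3.1 (3.43) p.398] -/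
theorem unitU3_pin (hc₀ : 0 < c₀) {am : ℝ} (ham : 0 < am) (μ : ℝ) :
    Real.sqrt (3 ^ 3 / (c₀ * ((F.L : ℝ) ^ (K - n)) ^ 3) * 8) * (Real.sqrt (8 * Real.exp (3 * min μ (1 / 4)) * Real.exp (6 * μ) * (2 * (1 + 1 / μ)) ^ 3) * ((8 * Real.sqrt (max 2 (16 * c₀ * ((F.L : ℝ) ^ (K - n)) ^ 3 / (am * (c₀ * ((F.L : ℝ) ^ 3) ^ (K - n))))) ^ 2) * (Real.sqrt ((25 / 8) * ((c₀ * ((F.L : ℝ) ^ 3) ^ (K - n)) * ((((F.P K).L : ℝ) ^ (F.P K).d) ^ (K - n))⁻¹ / c₀)) * Real.sqrt (2 * (c₀ * ((F.L : ℝ) ^ 3) ^ (K - n)))))) = Real.sqrt 432 * (Real.sqrt (8 * Real.exp (3 * min μ (1 / 4)) * Real.exp (6 * μ) * (2 * (1 + 1 / μ)) ^ 3) * ((8 * max 2 (16 / am)) * Real.sqrt (25 / 8))) := by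
  have hL : (0 : ℝ) < F.L := by have := F.hL.2; exact_mod_cast (by omega : 0 < F.L)
  have hPL : ((F.P K).L : ℝ) = (F.L : ℝ) := by norm_cast
  have hX : ((((F.P K).L : ℝ) ^ (F.P K).d) ^ (K - n)) = ((F.L : ℝ) ^ 3) ^ (K - n) := by rw [hPL, T3Family.P_d]
  have h3 : ((F.L : ℝ) ^ 3) ^ (K - n) ≠ 0 := by positivity
  have hS : (25 / 8 : ℝ) * ((c₀ * ((F.L : ℝ) ^ 3) ^ (K - n)) * ((((F.P K).L : ℝ) ^ (F.P K).d) ^ (K - n))⁻¹ / c₀) = 25 / 8 := by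
    rw [hX]; field_simp
  have hM : 16 * c₀ * ((F.L : ℝ) ^ (K - n)) ^ 3 / (am * (c₀ * ((F.L : ℝ) ^ 3) ^ (K - n))) = 16 / am := by
    rw [← pow_mul, ← pow_mul, mul_comm (K - n) 3]
    have h3' : (F.L : ℝ) ^ (3 * (K - n)) ≠ 0 := by positivity
    field_simp
  have hM2 : Real.sqrt (max 2 (16 / am)) ^ 2 = max 2 (16 / am) := Real.sq_sqrt (le_trans zero_le_two (le_max_left _ _))
  -- the `B₂` leaf pairs with the trailing `√(2c₁)`: `√(3³∕(c₀ℓ³)·8)·√(2c₀(L³)^{K−n}) = √432`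
  have hprod : 3 ^ 3 / (c₀ * ((F.L : ℝ) ^ (K - n)) ^ 3) * 8 * (2 * (c₀ * ((F.L : ℝ) ^ 3) ^ (K - n))) = 432 := by
    rw [← pow_mul, ← pow_mul, mul_comm (K - n) 3]
    have h3' : (F.L : ℝ) ^ (3 * (K - n)) ≠ 0 := by positivity
    field_simp
    ring
  have hCr : Real.sqrt (3 ^ 3 / (c₀ * ((F.L : ℝ) ^ (K - n)) ^ 3) * 8) * Real.sqrt (2 * (c₀ * ((F.L : ℝ) ^ 3) ^ (K - n))) = Real.sqrt 432 := by
    rw [← Real.sqrt_mul (by positivity), hprod]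
  rw [hS, hM, hM2]
  calc Real.sqrt (3 ^ 3 / (c₀ * ((F.L : ℝ) ^ (K - n)) ^ 3) * 8) * (Real.sqrt (8 * Real.exp (3 * min μ (1 / 4)) * Real.exp (6 * μ) * (2 * (1 + 1 / μ)) ^ 3) * ((8 * max 2 (16 / am)) * (Real.sqrt (25 / 8) * Real.sqrt (2 * (c₀ * ((F.L : ℝ) ^ 3) ^ (K - n))))))
        = (Real.sqrt (3 ^ 3 / (c₀ * ((F.L : ℝ) ^ (K - n)) ^ 3) * 8) * Real.sqrt (2 * (c₀ * ((F.L : ℝ) ^ 3) ^ (K - n)))) * (Real.sqrt (8 * Real.exp (3 * min μ (1 / 4)) * Real.exp (6 * μ) * (2 * (1 + 1 / μ)) ^ 3) * ((8 * max 2 (16 / am)) * Real.sqrt (25 / 8))) := by ring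
    _ = _ := by rw [hCr]

end Pin

/-! ## §2 (ii-d): (ii-c) at the pin — V6's `hDcol` with a MEMBER-FREE constant -/

section Member

variable (F : T3Family) {n K : ℕ} (h : n ≤ K) {c₀ : ℝ} [Fact (0 < c₀)]
  {ε₀ : ℝ} (hε₀ : 0 < ε₀) (hε7 : 10 ^ 7 * (F.L : ℝ) ^ 3 * ε₀ ≤ 1)
  (U₀ : GaugeField (F.P K) 0 (Matrix.specialUnitaryGroup (Fin 2) ℂ)) (hreg : RegPr F n K ε₀ U₀)
  (Q'' : SiteL2K ℂ 3 (periodsT3 F K) c₀ W₂ →ₗ[ℂ] (Site (F.P K) (K - n) → Matrix (Fin 2) (Fin 2) ℂ))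
  (hseq : ∀ lam : Site (F.P K) 0 → Matrix (Fin 2) (Fin 2) ℂ, ∃ ns : (j : ℕ) → Site (F.P K) j → Matrix (Fin 2) (Fin 2) ℂ, ns 0 = lam ∧
      (∀ (j : ℕ) (y : Site (F.P K) (j + 1)), ns (j + 1) y = ns j (emb y) - meanCLM (Idx (F.P K)) (Matrix (Fin 2) (Fin 2) ℂ) fun i : Idx (F.P K) =>
        ns j (emb y) - ((holT (emlIterU j (bgUnits F K U₀)) (emb y) (stairWord i.2.1 (off i.1)) : (Matrix (Fin 2) (Fin 2) ℂ)ˣ) : Matrix (Fin 2) (Fin 2) ℂ) *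
          ns j (transl (emb y) (disp (stairWord i.2.1 (off i.1)))) * (((holT (emlIterU j (bgUnits F K U₀)) (emb y) (stairWord i.2.1 (off i.1)))⁻¹ : (Matrix (Fin 2) (Fin 2) ℂ)ˣ) : Matrix (Fin 2) (Fin 2) ℂ)) ∧
      ns (K - n) = Q'' (toL2S F K c₀ lam))

include hε₀ hε7 hreg hseq in
/-- ★★★ **(ii-d) THE CURVED MEMBER GRADIENT ROW AT THE PIN, MEMBER-FREE CONSTANT** — px19 g13's (ii-c) ✓`Prop7CurvedMemberGradientRowOfRegPr.column_gradient_decay_of_regPr` (V6's `hDcol`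
from `RegPr` + the LOD letters + `hroom` + `hsmall`) at ★p1's pin `c₁ := c₀(L³)^{K−n}` and any massive weight `am > 0`, with V4's Agmon window DISCHARGED by routeR-w4's W1 letters
(✓`window_delta` at `3μ ≤ 1`, the `hwin` row displayed as the pure numeric `hwinμ`), and the constant REWRITTEN leaf by leaf (§1 (A)(U1)(U2)(U3)) into
`Cg⋆(am, μ, ε₀)` — NO `K`, `n`, `c₀`, `|T³|`: the same number for every member of a family. This is the `hDcolU` input of ✓∕⧗`Prop7KernelRow349MemberKnit.kernelRow349_member_of_gradColU`.
[cite: Balaban1985BackgroundPropagators, Thm 3.1 (3.42)–(3.44) pp.397–398, (3.24) p.394, (3.49) p.399] -/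
theorem column_gradient_decay_pin [hc₁ : Fact (0 < c₀ * ((F.L : ℝ) ^ 3) ^ (K - n))]
    (ι : (Site (F.P K) (K - n) → Matrix (Fin 2) (Fin 2) ℂ) →ₗ[ℂ] SiteL2K ℂ 3 (periodsT3 F n) (c₀ * ((F.L : ℝ) ^ 3) ^ (K - n)) W₂)
    (hι : ∀ c, ι c = toL2S F n (c₀ * ((F.L : ℝ) ^ 3) ^ (K - n)) (fun z => c (siteShift (sites_eq F n K h) z)))
    (T : SiteL2K ℂ 3 (periodsT3 F n) (c₀ * ((F.L : ℝ) ^ 3) ^ (K - n)) W₂ →ₗ[ℂ] SiteL2K ℂ 3 (periodsT3 F K) c₀ W₂)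
    (hT : ∀ (l : SiteL2K ℂ 3 (periodsT3 F K) c₀ W₂) (f : SiteL2K ℂ 3 (periodsT3 F n) (c₀ * ((F.L : ℝ) ^ 3) ^ (K - n)) W₂), ⟪ι (Q'' l), f⟫_ℂ = ⟪l, T f⟫_ℂ)
    {am : ℝ} (ham : 0 < am)
    (G : SiteL2K ℂ 3 (periodsT3 F K) c₀ W₂ →ₗ[ℂ] SiteL2K ℂ 3 (periodsT3 F K) c₀ W₂)
    (hAG : ∀ f, covLapSite F n K c₀ U₀ (G f) + (am : ℂ) • T (ι (Q'' (G f))) = f)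
    {μ : ℝ} (hμ : 0 < μ) (hμ3 : 3 * μ ≤ 1)
    (hwinμ : Real.sqrt (max 2 (16 / am)) * (Real.sqrt (27 + 2025 / 8 * am) * μ) ≤ 1 / 10)
    (hroom : 2 * (12 * F.L ^ (K - n) + 5) ≤ (F.P K).sitesPerDir 0)
    (hsmall : exists_curved_localGradient.choose * (48 * ε₀ * (6 * Real.sqrt 2 * Real.sqrt 10 + 6 * Real.sqrt 2)) * Real.exp (51 * (min μ (1 / 4) / 2)) ≤ 1 / 2) :
    ∀ (y : Site (F.P K) (K - n)) (Y : Matrix (Fin 2) (Fin 2) ℂ) (b : PBond (F.P K) 0),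
      ‖WL2.equiv ℂ _ W₂ (DL2 F n K c₀ U₀ (G (T (ι (Pi.single y Y))))) (bondEquiv F K b)‖
        ≤ (2 * (exists_curved_localGradient.choose * ((14 * (8 * Real.exp (3 * min μ (1 / 4)) * (5 / 2 + Real.exp (3 * μ) * (am * (5 / 2) * (25 / 8) * (8 * max 2 (16 / am))))) + Real.sqrt 432 * (Real.sqrt (8 * Real.exp (3 * min μ (1 / 4)) * Real.exp (6 * μ) * (2 * (1 + 1 / μ)) ^ 3) * ((8 * max 2 (16 / am)) * Real.sqrt (25 / 8)))) * Real.exp (51 * (min μ (1 / 4) / 2)) * (2 + 2 * Real.sqrt 2 * (4 * ε₀ * (3 + 2457 * norm_bgOfCfg_axialT_sub_le.choose)) + (24 * Real.sqrt 10 + 48) * (48 * ε₀) ^ 2) + (am * (5 / 2) * (25 / 8) * (Real.exp (3 * μ) * (8 * max 2 (16 / am))) + 5 / 2) * Real.exp (51 * (min μ (1 / 4) / 2))) + 2 * Real.sqrt 2 * (48 * ε₀) * ((14 * (8 * Real.exp (3 * min μ (1 / 4)) * (5 / 2 + Real.exp (3 * μ) * (am * (5 / 2) * (25 / 8) * (8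 * max 2 (16 / am))))) + Real.sqrt 432 * (Real.sqrt (8 * Real.exp (3 * min μ (1 / 4)) * Real.exp (6 * μ) * (2 * (1 + 1 / μ)) ^ 3) * ((8 * max 2 (16 / am)) * Real.sqrt (25 / 8)))) * Real.exp (51 * (min μ (1 / 4) / 2)))))
          * Real.exp (-((min μ (1 / 4) / 2) * (Site.tdist (P := F.P K) (iterBlockOf (K - n) b.src) y : ℝ))) * ‖Y‖ := by
  have hc₀ : 0 < c₀ := Fact.out
  have hL : (0 : ℝ) < F.L := by have := F.hL.2; exact_mod_cast (by omega : 0 < F.L)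
  have hL1 : (1 : ℝ) ≤ F.L := by have := F.hL.2; exact_mod_cast (by omega : 1 ≤ F.L)
  have hPL : ((F.P K).L : ℝ) = (F.L : ℝ) := by norm_cast
  have hX : ((((F.P K).L : ℝ) ^ (F.P K).d) ^ (K - n)) = ((F.L : ℝ) ^ 3) ^ (K - n) := by rw [hPL, T3Family.P_d]
  have h3 : ((F.L : ℝ) ^ 3) ^ (K - n) ≠ 0 := by positivity
  -- the two pin identities the W1 letters read
  have hS : (25 / 8 : ℝ) * ((c₀ * ((F.L : ℝ) ^ 3) ^ (K - n)) * ((((F.P K).L : ℝ) ^ (F.P K).d) ^ (K - n))⁻¹ / c₀) = 25 / 8 := by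
    rw [hX]; field_simp
  have hM : 16 * c₀ * ((F.L : ℝ) ^ (K - n)) ^ 3 / (am * (c₀ * ((F.L : ℝ) ^ 3) ^ (K - n))) = 16 / am := by
    rw [← pow_mul, ← pow_mul, mul_comm (K - n) 3]
    have h3' : (F.L : ℝ) ^ (3 * (K - n)) ≠ 0 := by positivity
    field_simp
  -- V4's Agmon window at slope `μ`: `window_delta` (`3μ ≤ 1`) and the displayed `hwinμ`
  have hη : 0 < eta F n K := eta_pos F n K
  have hη1 : eta F n K ≤ 1 := by
    show ((F.L : ℝ)⁻¹) ^ (K - n) ≤ 1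
    exact pow_le_one₀ (inv_nonneg.2 hL.le) (inv_le_one_of_one_le₀ hL1)
  have hδ := window_delta (a := am) (sx := (25 / 8 : ℝ) * ((c₀ * ((F.L : ℝ) ^ 3) ^ (K - n)) * ((((F.P K).L : ℝ) ^ (F.P K).d) ^ (K - n))⁻¹ / c₀))
    (η := eta F n K) ham hS hη hη1 hμ.le hμ3
  have hδ₁ : 0 ≤ Real.sqrt (27 + 2025 / 8 * am) * μ := by positivity
  have hwin : Real.sqrt (max 2 (16 * c₀ * ((F.L : ℝ) ^ (K - n)) ^ 3 / (am * (c₀ * ((F.L : ℝ) ^ 3) ^ (K - n))))) * (Real.sqrt (27 + 2025 / 8 * am) * μ) ≤ 1 / 10 := by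
    rw [hM]; exact hwinμ
  -- (ii-c), then the four leaf identities
  have hcol := column_gradient_decay_of_regPr F h hε₀ hε7 U₀ hreg Q'' hseq ι hι T hT ham G hAG hμ hδ₁ hδ hwin hroom hsmall
  intro y Y b
  have h1 := hcol y Y b
  rw [unitU2_pin F hc₀ ham μ, unitU1_pin F hc₀ ham, unitU3_pin F hc₀ ham μ, unitA_pin F hc₀] at h1
  exact h1

end Member

end Summit.QuantumFields.YangMills.Theorems.Prop7CurvedMemberGradientRowPin

end
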